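import Literature.AlgebraicGeometry.Resolution.Temkin2008Localization
import Literature.AlgebraicGeometry.Resolution.BlowupsFlatBaseChange
import Literature.AlgebraicGeometry.Resolution.ProOpenIdealExtension
import Literature.AlgebraicGeometry.Resolution.RegularLocusOpen
import Literature.AlgebraicGeometry.Resolution.BlowupsExistence
import Literature.AlgebraicGeometry.Resolution.BlowupsComposition
import HarnessLib

/-!
# Temkin 2008, Prop. 2.3.4 (localization of desingularization): the Noetherian induction

Topic: `Literature/AlgebraicGeometry/Resolution`. Sibling proof file of
`Temkin2008Localization.lean`, towards the discharge of its named fact `Temkin2008_prop234`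
(Temkin 2008, Prop. 2.3.4, variant (1) "the resolution is not embedded and `Z = Z' = ∅`",
implication (iii)⇒(ii) at `d = ∞`: over a Noetherian quasi-excellent scheme `k`, if the blow-ups
`S'` of the local schemes `S = Spec 𝒪_{X,x}` (for `X` of finite type over `k`) with
`S'_sing ⊆ f⁻¹(s)` admit desingularizations, then every integral `k`-scheme of finite type
admits a desingularization).

This file PROVES the proposition from the one ingredient of the printed proof that is not yet in
the tree, taken as the hypothesis `hcomp` of `temkin2008_prop234_of_comp`: **Temkin's
Lemma 2.1.4** (arXiv p. 7: "If `X` is coherent (i.e. quasi-compact and quasi-separated), `V ↪ X`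
is open and `T = X ∖ V`, then a composition of `V`-admissible (or `T`-supported) blow ups is a
`V`-admissible (or `T`-supported) blow up", with "a surprisingly involved full proof due to
Raynaud" in [Con1]; Stacks, Tag 080B), in the Noetherian two-step form in which the proof of
Prop. 2.3.4 uses it: for a Noetherian scheme `Y`, a blow-up `p : Y' → Y` along `P` with
`Supp P ⊆ T` followed by a blow-up `p' : Y'' → Y'` along `P'` with `Supp P' ⊆ p⁻¹(T)` is a
blow-up of `Y` along some `Q` with `Supp Q ⊆ T`. Everything else in the printed proof
(arXiv p. 12) is formalized here over the infrastructure landed for this decomposition: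

* `exists_maximal_point_of_isClosed` — a nonempty closed subset of a quasi-sober `T₀` space has
  a maximal point (one with no proper generization inside the subset): the generic point of a
  maximal irreducible closed subset (Zorn), Temkin's "let `x` be a maximal point of `X ∖ U`";
* `Temkin2008_prop234_holds` — **DISCHARGE of the named fact `Temkin2008_prop234`**
  (`temkin2008_prop234_of_comp` fed with `IsBlowup.exists_isBlowup_comp_supported` of
  `BlowupsComposition.lean`).
* `temkin2008_prop234_of_comp` — **Prop. 2.3.4, (iii)⇒(ii), `Z = ∅`, `d = ∞`, from Lemma 2.1.4.**
  The printed Noetherian induction, run as a well-founded induction on the closed set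
  `C = X ∖ U` of `X` (a Noetherian topological space) carrying the data "`f : X' → X` is a blow-up
  along `J` with `Supp J ⊆ X_sing` and `f⁻¹(X ∖ C) ⊆ X'_reg`", started at `C = X_sing`
  (closed: `X` is of finite type over the quasi-excellent `k`, `RegularLocusOpen.lean`),
  `f = 𝟙`, `J = ⊤`. Step: for a maximal point `x` of `C`, the pro-open pro-subscheme
  `S' = X' ×_X Spec 𝒪_{X,x} → Spec 𝒪_{X,x}` is a blow-up (`BlowupsFlatBaseChange.lean`) whose
  singular points lie over the closed point (`S'_sing = X'_sing ∩ S'`, maximality of `x`);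
  condition (iii) desingularizes it by a blow-up along `𝓘` supported on `S'_sing`; `𝓘` extends
  to `𝓙 ⊆ 𝒪_{X'}` supported on the closure (Lemma 2.1.1, `ProOpenIdealExtension.lean`);
  `X'' = Bl_𝓙(X') → X' → X` is an `X_sing`-supported blow-up by `hcomp`; its non-regular locus
  has closed image `C'` (blow-ups of locally Noetherian schemes are proper,
  `BlowupsProperProofs.lean`; `X''_sing` is closed), and `C' ⊆ C ∖ {x}`: off `C` because `f'`
  is an isomorphism off `Supp 𝓙 ⊆ f⁻¹(C)`, over `x` because `X'' ×_{X'} S'` is a blow-up of `S'`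
  along `𝓘` (flat base change), i.e. the regular scheme `S''` (uniqueness of blow-ups), and
  `X'' ×_{X'} S' → X''` identifies local rings.

## Faithfulness notes

* The printed proof treats the strict embedded case and says "Similar conditions are equivalent
  when: (1) the resolution is not embedded and `Z = Z' = ∅`"; with `Z = ∅` the pair-regular locus
  `(X, Z)_reg` is `X_reg` and strictness (`(X,Z)_sing`-supported) is the `X_reg`-admissibility
  built into `IsDesingularization`, so the argument above is the printed one verbatim with
  `Z = ∅`; the dimension bookkeeping (`x ∈ X^{<d}`, `dim S' ≤ dim S < d`) is vacuous at `d = ∞`.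
* `hcomp` is exactly the instance of Lemma 2.1.4 invoked in the printed proof ("Therefore,
  `f'' = f ∘ f'` is a `V`-admissible blow up"), for Noetherian `X` (the only case needed:
  `X` is of finite type over the Noetherian `k`); it is discharged in
  `BlowupsComposition.lean` (`IsBlowup.exists_isBlowup_comp_supported`, Stacks 080A/080B over
  the universal property), whence `Temkin2008_prop234_holds` — the named fact
  `Temkin2008_prop234` is now a THEOREM.

## Sources

* M. Temkin, *Desingularization of quasi-excellent schemes in characteristic zero*, Adv. Math.
  219 (2008) 488–522 = arXiv:math/0703678: §2.1 Lemma 2.1.1 (p. 6), Lemma 2.1.4 (p. 7),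
  Def. 2.2.6 (p. 10), Def. 2.3.1 (p. 11), Prop. 2.3.4 and its proof (p. 12) (arXiv pagination).
  [Temkin2008]
* The Stacks Project, Tag 080B (composition of blow-ups in finitely presented centres),
  Tag 01J7 (`Spec 𝒪_{X,x} → X`). [StacksProject]
-/

noncomputable section

open CategoryTheory CategoryTheory.Limits AlgebraicGeometry TopologicalSpace IsLocalRing

namespace Literature.AlgebraicGeometry.Resolution

universe u

/-- In a quasi-sober `T₀` space, every nonempty closed subset `C` has a **maximal point**: a point
`x ∈ C` none of whose proper generizations lies in `C` (the generic point of a maximal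
irreducible closed subset of `C` through a given point). [folklore] -/
theorem exists_maximal_point_of_isClosed {α : Type*} [TopologicalSpace α] [QuasiSober α]
    [T0Space α] {C : Set α} (hC : IsClosed C) {c : α} (hc : c ∈ C) :
    ∃ x ∈ C, ∀ y ∈ C, y ⤳ x → y = x := by
  obtain ⟨m, hcm, hm⟩ : ∃ m, ({c} : Set α) ⊆ m ∧
      Maximal (· ∈ {t : Set α | IsPreirreducible t ∧ t ⊆ C}) m := by
    refine zorn_subset_nonempty _ (fun ch hch hchain _ => ?_) {c}
      ⟨isPreirreducible_singleton, Set.singleton_subset_iff.mpr hc⟩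
    refine ⟨⋃₀ ch, ⟨?_, Set.sUnion_subset fun s hs => (hch hs).2⟩,
      fun s hs => Set.subset_sUnion_of_mem hs⟩
    intro u v hu hv ⟨y, hy, hyu⟩ ⟨z, hz, hzv⟩
    obtain ⟨p, hpc, hyp⟩ := Set.mem_sUnion.1 hy
    obtain ⟨q, hqc, hzq⟩ := Set.mem_sUnion.1 hz
    rcases hchain.total hpc hqc with hpq | hqp
    · obtain ⟨w, hwq, hwuv⟩ := (hch hqc).1 u v hu hv ⟨y, hpq hyp, hyu⟩ ⟨z, hzq, hzv⟩
      exact ⟨w, Set.mem_sUnion_of_mem hwq hqc, hwuv⟩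
    · obtain ⟨w, hwp, hwuv⟩ := (hch hpc).1 u v hu hv ⟨y, hyp, hyu⟩ ⟨z, hqp hzq, hzv⟩
      exact ⟨w, Set.mem_sUnion_of_mem hwp hpc, hwuv⟩
  have hm_irr : IsIrreducible m := ⟨⟨c, hcm (Set.mem_singleton c)⟩, hm.prop.1⟩
  have hmC : m ⊆ C := hm.prop.2
  have hm_closed : IsClosed m := by
    have h1 : closure m ∈ {t : Set α | IsPreirreducible t ∧ t ⊆ C} :=
      ⟨isPreirreducible_iff_closure.mpr hm.prop.1, hC.closure_subset_iff.mpr hmC⟩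
    rw [hm.eq_of_subset h1 subset_closure]
    exact isClosed_closure
  have hx : IsGenericPoint hm_irr.genericPoint m := hm_irr.isGenericPoint_genericPoint hm_closed
  refine ⟨hm_irr.genericPoint, hmC hx.mem, fun y hy hyx => ?_⟩
  have hsub : m ⊆ closure {y} := by
    rw [← hx.def]
    exact closure_minimal (Set.singleton_subset_iff.mpr (specializes_iff_mem_closure.mp hyx))
      isClosed_closure
  have h2 : closure {y} ∈ {t : Set α | IsPreirreducible t ∧ t ⊆ C} :=
    ⟨isPreirreducible_iff_closure.mpr isPreirreducible_singleton,
      hC.closure_subset_iff.mpr (Set.singleton_subset_iff.mpr hy)⟩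
  have heq : m = closure {y} := hm.eq_of_subset h2 hsub
  have hy' : IsGenericPoint y m := by
    rw [heq]
    exact isGenericPoint_closure
  exact hy'.eq hx

/-- **Temkin 2008, Prop. 2.3.4** ((iii)⇒(ii), not embedded, `Z = ∅`, `d = ∞`) from the
composition lemma for supported blow-ups (Temkin's Lemma 2.1.4 = Raynaud, in the Noetherian
two-step form `hcomp`): the Noetherian induction of the printed proof (arXiv p. 12).
[cite: Temkin2008, Prop. 2.3.4 (proof, p. 12)] -/
theorem temkin2008_prop234_of_comp
    (hcomp : ∀ ⦃Y Y' Y'' : Scheme.{u}⦄ [IsNoetherian Y] (p : Y' ⟶ Y) (P : Y.IdealSheafData)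
      (p' : Y'' ⟶ Y') (P' : Y'.IdealSheafData) (T : Set Y), IsBlowup p P →
      (P.support : Set Y) ⊆ T → IsBlowup p' P' → (P'.support : Set Y') ⊆ p ⁻¹' T →
      ∃ Q : Y.IdealSheafData, IsBlowup (p' ≫ p) Q ∧ (Q.support : Set Y) ⊆ T) :
    Temkin2008_prop234.{u} := by
  intro k _ hk hloc X f₀ _ _ _
  -- `X` is a Noetherian scheme, its singular locus `T` is closed
  haveI : IsLocallyNoetherian X := LocallyOfFiniteType.isLocallyNoetherian f₀
  haveI : CompactSpace X := QuasiCompact.compactSpace_of_compactSpace f₀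
  haveI : IsNoetherian X := {}
  set T : Set X := (Scheme.regularLocus X)ᶜ with hT
  have hTc : IsClosed T := isClosed_compl_regularLocus_of_locallyOfFiniteType f₀ hk
  -- the induction statement
  suffices H : ∀ C : Closeds X, (C : Set X) ⊆ T →
      (∃ (X' : Scheme.{u}) (f : X' ⟶ X) (J : X.IdealSheafData), IsBlowup f J ∧
        (J.support : Set X) ⊆ T ∧ ∀ x' : X', f x' ∉ C → x' ∈ Scheme.regularLocus X') →
      Scheme.AdmitsDesingularization X by
    refine H ⟨T, hTc⟩ subset_rfl ⟨X, 𝟙 X, ⊤, isBlowup_id_top X, ?_, fun x' hx' => ?_⟩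
    · simp [Scheme.IdealSheafData.support_top]
    · simpa [hT] using hx'
  intro C
  induction C using WellFoundedLT.induction with
  | ind C ih =>
  intro hCT ⟨X', f, J, hf, hJ, hreg⟩
  -- either `X'` is already regular …
  by_cases hall : ∀ x' : X', x' ∈ Scheme.regularLocus X'
  · exact ⟨X', f, ⟨J, hf, hJ⟩, fun x' => (Scheme.mem_regularLocus x').mp (hall x')⟩
  -- … or `C` is nonempty; pick a maximal point `x` of `C`
  push Not at hall
  obtain ⟨x₁, hx₁⟩ := hall
  have hx₁C : f x₁ ∈ (C : Set X) := by
    by_contra h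
    exact hx₁ (hreg x₁ h)
  obtain ⟨x, hxC, hmax⟩ := exists_maximal_point_of_isClosed C.isClosed hx₁C
  -- `X'` is Noetherian, of finite type over `k`
  haveI : IsProper f := hf.isProper
  haveI : IsLocallyNoetherian X' := LocallyOfFiniteType.isLocallyNoetherian f
  haveI : CompactSpace X' := QuasiCompact.compactSpace_of_compactSpace f
  haveI : IsNoetherian X' := {}
  -- the local scheme `S = Spec 𝒪_{X,x}` and the pro-open pro-subscheme `S' = X' ×_X S` of `X'`
  haveI : Flat (X.fromSpecStalk x) := flat_fromSpecStalk X x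
  haveI : IsNoetherian (pullback f (X.fromSpecStalk x)) := {}
  have hgb : IsBlowup (pullback.snd f (X.fromSpecStalk x)) (J.comap (X.fromSpecStalk x)) :=
    hf.pullback_snd_of_flat (X.fromSpecStalk x)
  have hfj : ∀ s : ↑(pullback f (X.fromSpecStalk x)),
      f (pullback.fst f (X.fromSpecStalk x) s) =
        X.fromSpecStalk x (pullback.snd f (X.fromSpecStalk x) s) := fun s => by
    rw [← Scheme.Hom.comp_apply, pullback.condition, Scheme.Hom.comp_apply]
  -- `S'_sing ⊆ g⁻¹(s)`: a singular point of `S'` is singular in `X'`, hence lies over `C`, over a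
  -- generization of `x`, hence over `x` by maximality
  have hsing : ∀ s : ↑(pullback f (X.fromSpecStalk x)),
      s ∉ Scheme.regularLocus (pullback f (X.fromSpecStalk x)) →
        pullback.snd f (X.fromSpecStalk x) s = closedPoint (X.presheaf.stalk x) := by
    intro s hs
    have h1 : pullback.fst f (X.fromSpecStalk x) s ∉ Scheme.regularLocus X' := fun h =>
      hs ((mem_regularLocus_iff_pullback_fst_fromSpecStalk f x s).mpr h)
    have h2 : f (pullback.fst f (X.fromSpecStalk x) s) ∈ (C : Set X) := by
      by_contra h
      exact h1 (hreg _ h)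
    have h3 : X.fromSpecStalk x (pullback.snd f (X.fromSpecStalk x) s) ⤳ x :=
      Scheme.range_fromSpecStalk.le ⟨_, rfl⟩
    have h4 : X.fromSpecStalk x (pullback.snd f (X.fromSpecStalk x) s) = x :=
      hmax _ (hfj s ▸ h2) h3
    apply (X.fromSpecStalk x).isEmbedding.injective
    rw [h4, Scheme.fromSpecStalk_closedPoint]
  -- the local desingularization provided by condition (iii)
  obtain ⟨S'', g', hdes⟩ := hloc X f₀ x inferInstance (pullback f (X.fromSpecStalk x))
    (pullback.snd f (X.fromSpecStalk x)) (J.comap (X.fromSpecStalk x)) hgb hsing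
  obtain ⟨I', hg', hI'⟩ := hdes.exists_isBlowup
  have hS''reg := hdes.isRegular
  -- extend its centre to `X'` (Lemma 2.1.1) and blow `X'` up along the extension
  obtain ⟨J', hJ'I', hJ'supp⟩ := exists_idealSheaf_extension_fromSpecStalk f x I'
  obtain ⟨X'', f', hf'⟩ := exists_isBlowup X' J'
  -- the new centre lies over the closure of `x`, inside `C ⊆ T`
  have hIx : ∀ s ∈ (I'.support : Set ↑(pullback f (X.fromSpecStalk x))),
      f (pullback.fst f (X.fromSpecStalk x) s) = x := fun s hs => by
    rw [hfj, hsing s (hI' hs), Scheme.fromSpecStalk_closedPoint]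
  have hJ'C : f '' (J'.support : Set X') ⊆ (C : Set X) := by
    rw [hJ'supp]
    refine (image_closure_subset_closure_image f.continuous).trans ?_
    refine C.isClosed.closure_subset_iff.mpr ?_
    rintro _ ⟨_, ⟨s, hs, rfl⟩, rfl⟩
    rw [hIx s hs]
    exact hxC
  have hJ'T : (J'.support : Set X') ⊆ f ⁻¹' T := fun x' hx' => hCT (hJ'C ⟨x', hx', rfl⟩)
  -- so the composite is a `T`-supported blow-up of `X` (Lemma 2.1.4)
  obtain ⟨J₂, hf₂, hJ₂⟩ := hcomp f J f' J' T hf hJ hf' hJ'T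
  -- `X''` is of finite type over `k`: its singular locus is closed, with closed image `C'`
  haveI : IsProper f' := hf'.isProper
  have hreg'' : IsClosed (Scheme.regularLocus X'')ᶜ :=
    isClosed_compl_regularLocus_of_locallyOfFiniteType ((f' ≫ f) ≫ f₀) hk
  let C' : Closeds X :=
    ⟨(f' ≫ f) '' (Scheme.regularLocus X'')ᶜ, (f' ≫ f).isClosedMap _ hreg''⟩
  -- `C' ⊆ C ∖ {x}`
  have hC'C : (C' : Set X) ⊆ (C : Set X) \ {x} := by
    rintro _ ⟨x'', hx'', rfl⟩
    refine ⟨?_, ?_⟩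
    · -- over `X ∖ C`: `X'` is regular there and `f'` is an isomorphism off its centre
      by_contra hy
      have hy' : f (f' x'') ∉ (C : Set X) := by rwa [Scheme.Hom.comp_apply] at hy
      have h1 : f' x'' ∈ Scheme.regularLocus X' := hreg _ hy'
      have h2 : f' x'' ∉ (J'.support : Set X') := fun h => hy' (hJ'C ⟨_, h, rfl⟩)
      haveI := hf'.isIso_compl
      exact hx'' ((mem_regularLocus_iff_of_isIso_morphismRestrict f'
        ⟨(J'.support : Set X')ᶜ, J'.support.isClosed.isOpen_compl⟩ x'' h2).mpr h1)
    · -- over `x`: `X'' ×_{X'} S'` is the regular scheme `S''` (flat base change, uniqueness)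
      intro hyx
      rw [Set.mem_singleton_iff, Scheme.Hom.comp_apply] at hyx
      obtain ⟨s, hs⟩ := mem_range_pullback_fst_fromSpecStalk_of_eq f x hyx
      have hT' : IsBlowup (pullback.snd f' (pullback.fst f (X.fromSpecStalk x))) I' := by
        rw [← hJ'I']
        exact hf'.pullback_snd_of_flat _
      obtain ⟨e, -, -⟩ := hT'.unique hg'
      have hx''range : x'' ∈ Set.range (pullback.fst f' (pullback.fst f (X.fromSpecStalk x))) := by
        rw [Scheme.Pullback.range_fst]
        exact ⟨s, hs⟩
      obtain ⟨t, rfl⟩ := hx''range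
      apply hx''
      refine (mem_regularLocus_iff_of_flat_of_isPreimmersion _ t).mp ?_
      exact (mem_regularLocus_iff_of_flat_of_isPreimmersion e.hom t).mpr (hS''reg _)
  have hlt : C' < C := by
    refine lt_of_le_of_ne (fun y hy => (hC'C hy).1) fun h => ?_
    have hx' : x ∈ (C' : Set X) := by
      rw [h]
      exact hxC
    exact (hC'C hx').2 rfl
  exact ih C' hlt (fun y hy => hCT (hC'C hy).1)
    ⟨X'', f' ≫ f, J₂, hf₂, hJ₂, fun x'' hx'' => by
      by_contra h
      exact hx'' ⟨x'', h, rfl⟩⟩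

/-- **DISCHARGE of the named fact `Temkin2008_prop234`** (Temkin 2008, Prop. 2.3.4, variant (1)
"the resolution is not embedded and `Z = Z' = ∅`", (iii)⇒(ii), `d = ∞`): over a Noetherian
quasi-excellent scheme `k`, if the blow-ups `S'` of the local schemes `S = Spec 𝒪_{X,x}` of
finite type `k`-schemes with `S'_sing ⊆ f⁻¹(s)` admit desingularizations, then there is
resolution of singularities over `k`. The printed Noetherian induction
(`temkin2008_prop234_of_comp`) with Temkin's Lemma 2.1.4 in the Noetherian two-step form proved
in `BlowupsComposition.lean` (`IsBlowup.exists_isBlowup_comp_supported`, after Stacks 080A/080B).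
[cite: Temkin2008, Prop. 2.3.4] -/
theorem Temkin2008_prop234_holds : Temkin2008_prop234.{u} :=
  temkin2008_prop234_of_comp fun _Y _Y' _Y'' _hY p P p' P' T hp hPT hp' hP'T =>
    hp.exists_isBlowup_comp_supported p P p' P' T hPT hp' hP'T

end Literature.AlgebraicGeometry.Resolution

end
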